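import Literature.AlgebraicGeometry.HodgeTheory.AlgebraicityLocusCurves
import Literature.AlgebraicGeometry.Motives.HeightMorphism
import Literature.AlgebraicGeometry.Motives.ClosedSubvarietyOfPoint
import HarnessLib

/-!
# Dimension of a dominating piece of a family of small supports over a curve

Topic `Literature/AlgebraicGeometry/HodgeTheory` (family `hodge`). Theorems only (no definition, no
named fact, no `sorry`). Dimension-theoretic lemma behind the spreading step of the variational
Hodge conjecture over a curve (Voisin, *Hodge Theory II*, §3.3.1: "the cycles `Z_c` sweep out a
cycle whose restriction to every fibre has the same codimension"; Charles–Schnell 2014, proof of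
Prop. 11.3.11; the dimension count is Fulton §10.1), in the tree's support language and for a
family `g : 𝒲 ⟶ C` over a smooth curve whose total space need NOT be quasi-projective:

* `height_genericPoint_add_le_of_dense_piece` — let `q : 𝒲 ⟶ 𝒳`, `g : 𝒲 ⟶ C` with `g` proper
  (`𝒳`, `𝒲` locally of finite type over `ℂ`), `C` a smooth integral curve, `Z ⊆ 𝒲` closed whose
  slice over ONE complex point `a ∈ C(ℂ)` consists of points `z` with `height z + p ≤ n`
  (codimension `≥ p` in an `n`-dimensional fibre). If `V ⊆ (q, g)(Z) ⊆ 𝒳 × C` is an irreducible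
  closed piece whose projection to `C` is dense, then its generic point `ξ_V` lies over the generic
  point of `C` and `height ξ_V + p ≤ n + 1`. Proof: with its reduced structure `V` is an integral
  family dominating the smooth curve `C`, hence FLAT (Hartshorne III.9.7, the tree's
  `Motives.flat_of_isDominant_of_smoothCurve`); `(q, g)` followed by `pr_C` is the proper `g`, so the
  image of `V` in `C` is closed and dense, i.e. everything, and `V` has a fibre over `a`; a maximal
  point `w₀` of that fibre has `height w₀ + 1 = dim V` (Fulton §10.1, the tree's
  `Motives.height_familyFiber_add_one_eq_of_isMax`) and is the image of a point of the slice of `Z`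
  over `a` under a morphism, which does not increase dimensions of closures of points
  (`Motives.height_base_le_height_of_schemeOver`).
Sequel: `SupportPropagationDominantCurve` (propagation of supports from a dominant parameter curve
to every fibre of a smooth proper family over a curve).

## References

* [VoisinHodgeII2003] C. Voisin, Hodge Theory and Complex Algebraic Geometry II (2003), §3.3.1.
* [CharlesSchnell2014Notes] F. Charles, C. Schnell, Notes on absolute Hodge classes (2014),
  Prop. 11.3.11 (proof).
* [Fulton1998] W. Fulton, Intersection Theory (1998), §10.1.
* [Hartshorne1977] R. Hartshorne, Algebraic Geometry (1977), III Prop. 9.7, II Ex. 3.22.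
* [GortzWedhorn2020] U. Görtz, T. Wedhorn, Algebraic Geometry I, 2nd ed. (2020), Thm. 5.22.
-/

noncomputable section

open CategoryTheory AlgebraicGeometry Limits Set Order MonoidalCategory CartesianMonoidalCategory
open _root_.Topology TopologicalSpace
open Literature.AlgebraicGeometry.Motives

namespace Literature.AlgebraicGeometry.HodgeTheory

section HodgeTheory

/-! ### The dimension bound on a dominating piece of a family of supports over a curve -/

section Piece

variable {𝒳 C 𝒲 : Motives.SchemeOver ℂ} (q : 𝒲 ⟶ 𝒳) (g : 𝒲 ⟶ C)

/-- **A piece of a family of small supports dominating the parameter curve is small.** Let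
`q : 𝒲 ⟶ 𝒳` and `g : 𝒲 ⟶ C` be morphisms of `ℂ`-schemes locally of finite type with `g` proper,
`C` a smooth integral curve, and `Z ⊆ 𝒲` closed whose slice over the complex point `a ∈ C(ℂ)`
consists of points `z` with `height z + p ≤ n`. If `V ⊆ (q, g)(Z) ⊆ 𝒳 × C` is an irreducible
closed piece whose projection to `C` is dense, then its generic point `ξ_V` has
`height ξ_V + p ≤ n + 1` and lies over the generic point of `C`. (With its reduced structure `V` is
an integral family dominating the smooth curve `C`, hence flat, Hartshorne III.9.7; `pr_C ∘ (q, g)`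
is the proper `g`, so the image of `V` in `C` is closed and dense, i.e. everything, and `V` has a
fibre over `a`; a maximal point `w₀` of that fibre has `height w₀ + 1 = dim V`, Fulton §10.1, and is
the image of a point of the slice of `Z` over `a` under a morphism, which does not increase
dimensions of closures of points.) [cite: Fulton1998, §10.1] [cite: Hartshorne1977, III Prop. 9.7] -/
theorem height_genericPoint_add_le_of_dense_piece [LocallyOfFiniteType 𝒳.hom]
    [LocallyOfFiniteType 𝒲.hom] [IsProper g.left] [LocallyOfFiniteType C.hom]
    [IsIntegral C.left] [SmoothOfRelativeDimension 1 C.hom] {n p : ℕ}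
    {Z : Set 𝒲.left} (hZ : IsClosed Z) (a : Motives.ComplexPoints C)
    (ha : ∀ z : (Motives.fiberOver g a).left,
      (Motives.fiberι g a).left.base z ∈ Z → height z + p ≤ (n : ℕ∞))
    {V : Set (𝒳 ⊗ C).left} (hVcl : IsClosed V) (hVirr : IsIrreducible V)
    (hVZ : V ⊆ (CartesianMonoidalCategory.lift q g).left.base '' Z)
    (hdom : closure ((CartesianMonoidalCategory.snd 𝒳 C).left.base '' V) = Set.univ) :
    height hVirr.genericPoint + p ≤ ((n + 1 : ℕ) : ℕ∞) ∧
      (CartesianMonoidalCategory.snd 𝒳 C).left.base hVirr.genericPoint = genericPoint C.left := by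
  classical
  -- the proper map `m = (q, g) : 𝒲 ⟶ 𝒳 × C`
  have hmsnd : ∀ z, (CartesianMonoidalCategory.snd 𝒳 C).left.base
      ((CartesianMonoidalCategory.lift q g).left.base z) = g.left.base z := fun z => by
    change (CartesianMonoidalCategory.lift q g ≫ CartesianMonoidalCategory.snd 𝒳 C).left.base z = _
    rw [lift_snd]
  have hmfst : ∀ z, (CartesianMonoidalCategory.fst 𝒳 C).left.base
      ((CartesianMonoidalCategory.lift q g).left.base z) = q.left.base z := fun z => by
    change (CartesianMonoidalCategory.lift q g ≫ CartesianMonoidalCategory.fst 𝒳 C).left.base z = _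
    rw [lift_fst]
  haveI : LocallyOfFiniteType (𝒳 ⊗ C).hom :=
    inferInstanceAs (LocallyOfFiniteType (pullback.fst 𝒳.hom C.hom ≫ 𝒳.hom))
  -- the generic point `ξ` of `V` and the integral closed subscheme `W` supported on `V`
  have hξ : IsGenericPoint hVirr.genericPoint V := hVirr.isGenericPoint_genericPoint hVcl
  let W : ClosedSubscheme (𝒳 ⊗ C).left :=
    (ClosedSubvariety.ofPoint (𝒳 ⊗ C).left hVirr.genericPoint).toClosedSubscheme
  have hWrange : Set.range W.ι.base = V :=
    (ClosedSubvariety.range_ofPoint_ι (X := (𝒳 ⊗ C).left) hVirr.genericPoint).trans hξ.def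
  have hWgen : W.ι.base (⊤ : W.carrier) = hVirr.genericPoint :=
    ClosedSubvariety.genericPoint_ofPoint (X := (𝒳 ⊗ C).left) hVirr.genericPoint
  -- `W` dominates `C`, hence is flat over it
  haveI hWdom : IsDominant (W.ι ≫ (CartesianMonoidalCategory.snd 𝒳 C).left) := by
    refine ⟨dense_iff_closure_eq.2 ?_⟩
    rw [Scheme.Hom.comp_base, TopCat.coe_comp, Set.range_comp, hWrange]
    exact hdom
  haveI : Flat (W.ι ≫ (CartesianMonoidalCategory.snd 𝒳 C).left) :=
    flat_of_isDominant_of_smoothCurve C _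
  -- the generic point of `W` lies over the generic point of `C`
  have hsndξ : (CartesianMonoidalCategory.snd 𝒳 C).left.base hVirr.genericPoint =
      genericPoint C.left := by
    rw [← hWgen]
    exact genericPoint_eq_of_isDominant' (W.ι ≫ (CartesianMonoidalCategory.snd 𝒳 C).left)
  refine ⟨?_, hsndξ⟩
  -- the image of `V` in `C` is closed (`g` is proper), hence everything: `V` has a point over `a`
  have hsndV : (CartesianMonoidalCategory.snd 𝒳 C).left.base '' V =
      g.left.base '' (Z ∩ (CartesianMonoidalCategory.lift q g).left.base ⁻¹' V) := by
    apply Set.Subset.antisymm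
    · rintro _ ⟨w, hw, rfl⟩
      obtain ⟨z, hz, rfl⟩ := hVZ hw
      exact ⟨z, ⟨hz, hw⟩, (hmsnd z).symm⟩
    · rintro _ ⟨z, ⟨-, hzV⟩, rfl⟩
      exact ⟨_, hzV, hmsnd z⟩
  have hsndVcl : IsClosed ((CartesianMonoidalCategory.snd 𝒳 C).left.base '' V) := by
    rw [hsndV]
    exact g.left.isClosedMap _
      (hZ.inter (hVcl.preimage (CartesianMonoidalCategory.lift q g).left.continuous))
  have hsndVuniv : (CartesianMonoidalCategory.snd 𝒳 C).left.base '' V = Set.univ := by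
    rw [← hsndVcl.closure_eq]; exact hdom
  obtain ⟨v, hvV, hva⟩ : a.pt ∈ (CartesianMonoidalCategory.snd 𝒳 C).left.base '' V := by
    rw [hsndVuniv]; exact Set.mem_univ _
  obtain ⟨b, hb⟩ : v ∈ Set.range W.ι.base := by rw [hWrange]; exact hvV
  have hb' : (W.ι ≫ (CartesianMonoidalCategory.snd 𝒳 C).left).base b =
      a.toSpecHom.base (IsLocalRing.closedPoint ℂ) := by
    rw [Scheme.Hom.comp_base, TopCat.coe_comp, Function.comp_apply, hb, hva]
    rfl
  -- a maximal point `w₀` of the fibre `W_a`; `height w₀ + 1 = dim W`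
  obtain ⟨wa, -⟩ := exists_fst_familyFiber_eq W a b hb'
  obtain ⟨w₀, hw₀, -⟩ := exists_isMax_specializes wa
  have hdimW : height w₀ + 1 = height (⊤ : W.carrier) :=
    height_familyFiber_add_one_eq_of_isMax W a w₀ hw₀
  -- `w₀` maps to a point `x₀` of `𝒳` with `(x₀, a) ∈ V ⊆ m(Z)`
  have hx₀ : height ((familyFiber W a).ι.base w₀) = height w₀ :=
    height_base_eq_of_isClosedImmersion' _ w₀
  have hx₀V : (sliceAt 𝒳 a).left.base ((familyFiber W a).ι.base w₀) ∈ V := by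
    have h : (familyFiber W a).ι.base w₀ ∈ Set.range (familyFiber W a).ι.base := ⟨w₀, rfl⟩
    rw [range_familyFiber_ι] at h
    rw [← hWrange]
    exact h
  obtain ⟨z₀, hz₀Z, hz₀⟩ := hVZ hx₀V
  -- `z₀` lies over `a`, so it is a point of the fibre `𝒲_a`
  have hgz₀ : g.left.base z₀ = a.pt := by
    rw [← hmsnd, hz₀]
    exact snd_sliceAt_base a _
  obtain ⟨z, hz⟩ := exists_fiberι_base_eq g a z₀ hgz₀
  have hzZ : (Motives.fiberι g a).left.base z ∈ Z := by rw [hz]; exact hz₀Z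
  have hzle : height z + p ≤ (n : ℕ∞) := ha z hzZ
  -- `height x₀ = height (x₀, a) = height (m z₀) ≤ height z₀ = height z`
  have hx₀le : height ((familyFiber W a).ι.base w₀) ≤ height z := by
    rw [← height_sliceAt_base_eq (𝒳 := 𝒳) a ((familyFiber W a).ι.base w₀), ← hz₀,
      ← height_fiberι_base_eq g a z, hz]
    exact height_base_le_height_of_schemeOver (CartesianMonoidalCategory.lift q g) z₀
  -- conclusion: `height ξ = dim W = height w₀ + 1 ≤ height z + 1`, and `height z + p ≤ n`
  have hξW : height (W.ι.base (⊤ : W.carrier)) = height (⊤ : W.carrier) :=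
    height_base_eq_of_isClosedImmersion' _ _
  rw [hWgen] at hξW
  have hw₀le : height w₀ + p ≤ (n : ℕ∞) := (add_le_add (hx₀ ▸ hx₀le) le_rfl).trans hzle
  rw [hξW, ← hdimW, add_right_comm, Nat.cast_add, Nat.cast_one]
  exact add_le_add hw₀le le_rfl

end Piece

end HodgeTheory

end Literature.AlgebraicGeometry.HodgeTheory

end
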